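import Literature.NumberTheory.QuadraticFields.IdealClassEpsteinContinuation
import Literature.NumberTheory.QuadraticFields.DedekindZetaReducedForms
import HarnessLib

/-!
# Inverse ideal classes and opposite forms: `[𝔞_{(A,−B,C)}] = [𝔞_{(A,B,C)}]⁻¹`, hence
# `ζ(𝔎⁻¹, s) = ζ(𝔎, s)` for imaginary quadratic fields; and `h(d) > 1 ⇒ h_K ≥ 2`, `d < −4`

Topic `NumberTheory/QuadraticFields`, namespace `Literature.NumberTheory.QuadraticFields.Quadratic`
(continuing `IdealClassEpsteinContinuation.lean`, `DedekindZetaReducedForms.lean`). Everything here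
is PROVED (theorems only, no definitions, no named facts).

Let `K` be an imaginary quadratic field, `(1, ω)` an integral basis with `ω² = m + tω`,
`d_K = t² + 4m < 0`, and for an integral form `Q = (A, B, C)` of discriminant `d_K` (automatically
primitive, `isUnit_of_dvd_of_disc_eq`) let `𝔞_Q = (A, ω − (B + t)/2)` be its ideal (Cox, Thm. 7.7).

* `span_formIdeal_mul_span_formIdeal_neg` — **`𝔞_{(A,B,C)} · 𝔞_{(A,−B,C)} = (A)`**: with
  `η = ω − (B+t)/2`, `η' = ω − (t−B)/2` one has `ηη' = −AC`, `A(η' − η)... = AB`, and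
  `gcd(A, B, C) = 1` puts `A` in the product (Cox, §7.B: the class of the opposite form
  `(a, −b, c)` is the inverse class; Thm. 7.7 (7.8)/(3.3));
* `mk0_formIdeal_neg_eq_inv` — hence `[𝔞_{(A,−B,C)}] = [𝔞_{(A,B,C)}]⁻¹` in `Cl(K)`;
* `classSumCont_inv_eq` — **`ζ(𝔎⁻¹, s) = ζ(𝔎, s)`** (`s ≠ 1`) for every ideal class `𝔎` of an
  imaginary quadratic field with `d_K < −4`: every class is `[𝔞_Q]⁻¹` for a form `Q` of discriminant
  `d_K` (`exists_heegnerForm_mk0_formIdeal_eq`), `ζ([𝔞_Q]⁻¹, s) = ½ Z_Q(s)`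
  (`classSumCont_eq_half_epsteinZeta`), the opposite form has the same Epstein zeta function
  (`epsteinZeta_neg_snd`) and the inverse class, and both sides are holomorphic on `ℂ ∖ {1}`
  (identity theorem); classically: `𝔞 ↦ 𝔞̄` is a norm-preserving bijection of `𝔎` onto `𝔎⁻¹`;
* `two_le_classNumber_of_twoFormClasses` — if two positive definite integral forms of
  discriminant `d_K` are not properly equivalent
  (`Literature.Barriers.RiemannHypothesis.TwoFormClasses d_K`, the hypothesis "`h(d) > 1`" of the
  barrier facts `DavenportHeilbronn1936b_epstein` / `Voronin1976_epsteinStrip`), then `h_K ≥ 2`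
  (reduction theory, Cox Thm. 2.8, and `h(d_K) = h_K`, `card_reducedForms_eq_classNumber'`);
* `lt_neg_four_of_twoFormClasses` — a negative fundamental discriminant `d` with `h(d) > 1` has
  `d < −4` (`h(−3) = h(−4) = 1`), so that `w = 2` and the dictionary of
  `IdealClassEpsteinContinuation.lean` applies.

## References

* [Cox2013] D. A. Cox, *Primes of the form x² + ny²*, 2nd ed. (2013), Thm. 2.8, §3.A (3.3),
  §7.B Thm. 7.7.
* D. B. Zagier, *Zetafunktionen und quadratische Körper*, Springer 1981, §8 (ζ(s, A) = ζ(s, A⁻¹)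
  through `Q_A` and `Q_{A⁻¹} = (a, −b, c)`).
-/

noncomputable section

open Module NumberField Ideal Complex Filter Set
open Literature.Barriers.RiemannHypothesis Literature.NumberTheory.QuadraticFields.BakerLimitFormula
open Literature.NumberTheory.LFunctions.NumberField (classSumCont classSumCont_eq_tsum
  differentiableOn_classSumCont thetaIdeal_inv_holds)
open Literature.NumberTheory.EllipticCurves (heegnerForms exists_heegnerForm_mk0_formIdeal_eq
  two_mul_ediv_two_of_disc_eq)
open Literature.NumberTheory.QuadraticFields.BinaryQuadraticForm (reducedForms mem_reducedForms_iff
  isReduced_iff discr_apply)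
open scoped nonZeroDivisors

namespace Literature.NumberTheory.QuadraticFields.Quadratic

/-! ### Bézout for `gcd(A, B, C) = 1`

(The parity fact `2 · ((B + t)/2) = B + t` for `B² − 4AC = t² + 4m` is
`Literature.NumberTheory.EllipticCurves.two_mul_ediv_two_of_disc_eq`.) -/

/-- `gcd(A, B, C) = 1` in Bézout form: `uA + vB + wC = 1`. [folklore] -/
private theorem exists_bezout_three {A B C : ℤ} (hprim : ∀ d : ℤ, d ∣ A → d ∣ B → d ∣ C → IsUnit d) :
    ∃ u v w : ℤ, u * A + v * B + w * C = 1 := by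
  set g₁ : ℕ := Int.gcd A B with hg₁
  set g : ℕ := Int.gcd (g₁ : ℤ) C with hg
  have hgA : (g : ℤ) ∣ A := (Int.gcd_dvd_left (g₁ : ℤ) C).trans (Int.gcd_dvd_left A B)
  have hgB : (g : ℤ) ∣ B := (Int.gcd_dvd_left (g₁ : ℤ) C).trans (Int.gcd_dvd_right A B)
  have hgC : (g : ℤ) ∣ C := Int.gcd_dvd_right (g₁ : ℤ) C
  have hg1 : g = 1 := by
    have hu := hprim (g : ℤ) hgA hgB hgC
    rw [Int.isUnit_iff_natAbs_eq, Int.natAbs_natCast] at hu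
    exact hu
  have hg1' : (g : ℤ) = 1 := by exact_mod_cast hg1
  have e₁ : (g₁ : ℤ) = A * Int.gcdA A B + B * Int.gcdB A B := Int.gcd_eq_gcd_ab A B
  have e₂ : (g : ℤ) = (g₁ : ℤ) * Int.gcdA (g₁ : ℤ) C + C * Int.gcdB (g₁ : ℤ) C := Int.gcd_eq_gcd_ab _ _
  exact ⟨Int.gcdA A B * Int.gcdA (g₁ : ℤ) C, Int.gcdB A B * Int.gcdA (g₁ : ℤ) C, Int.gcdB (g₁ : ℤ) C,
    by linear_combination -(Int.gcdA (g₁ : ℤ) C) * e₁ - e₂ + hg1'⟩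

section Basis

variable {K : Type*} [Field K] [NumberField K]

/-- **`𝔞_{(A,B,C)} · 𝔞_{(A,−B,C)} = (A)`** for a primitive form `(A, B, C)` of discriminant
`t² + 4m = d_K`: with `η = ω − k`, `η' = ω − k'`, `k = (B + t)/2`, `k' = (t − B)/2` (`k + k' = t`,
`k − k' = B`), the product `(A, η)(A, η') = (A², Aη', Aη, ηη')` has `ηη' = −AC` and contains
`A(η' − η)... = AB`, hence `A = uA² + vAB + wAC` (`uA + vB + wC = 1`); conversely every generator is
a multiple of `A`. [cite: Cox2013, §7.B Thm. 7.7 and §3.A (3.3)] -/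
theorem span_formIdeal_mul_span_formIdeal_neg (b : Basis (Fin 2) ℤ (𝓞 K)) (hb : b 0 = 1)
    {t m : ℤ} (hω : b 1 * b 1 = (m : 𝓞 K) + (t : 𝓞 K) * b 1) {A B C : ℤ}
    (hdisc : B ^ 2 - 4 * A * C = t ^ 2 + 4 * m)
    (hprim : ∀ d : ℤ, d ∣ A → d ∣ B → d ∣ C → IsUnit d) :
    span {(A : 𝓞 K), b 1 - (((B + t) / 2 : ℤ) : 𝓞 K)} *
        span {(A : 𝓞 K), b 1 - (((-B + t) / 2 : ℤ) : 𝓞 K)} = span {(A : 𝓞 K)} := by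
  have _ := hb
  set k : ℤ := (B + t) / 2 with hk
  set k' : ℤ := (-B + t) / 2 with hk'
  have h2k : 2 * k = B + t := two_mul_ediv_two_of_disc_eq hdisc
  have h2k' : 2 * k' = -B + t :=
    two_mul_ediv_two_of_disc_eq (A := A) (B := -B) (C := C) (t := t) (m := m) (by rw [← hdisc]; ring)
  have hkk' : k + k' = t := by omega
  have hkB : k - k' = B := by omega
  have hAC : A * C = -(k * k') - m := by
    have h := hdisc
    rw [← hkB, ← hkk'] at h
    have h4 : 4 * (A * C) = 4 * (-(k * k') - m) := by linear_combination -h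
    exact Int.eq_of_mul_eq_mul_left (by norm_num) h4
  set η : 𝓞 K := b 1 - (k : 𝓞 K) with hη
  set η' : 𝓞 K := b 1 - (k' : 𝓞 K) with hη'
  -- `η η' = -AC`
  have hηη' : η * η' = -((A : 𝓞 K) * (C : 𝓞 K)) := by
    have e1 : η * η' = b 1 * b 1 - ((k + k' : ℤ) : 𝓞 K) * b 1 + ((k * k' : ℤ) : 𝓞 K) := by
      rw [hη, hη']; push_cast; ring
    rw [e1, hω, hkk', show (A : 𝓞 K) * (C : 𝓞 K) = ((A * C : ℤ) : 𝓞 K) by push_cast; ring, hAC]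
    push_cast; ring
  -- `A (η' - η)... : η - η' = -(k - k') = -B`
  have hηsub : η' - η = (B : 𝓞 K) := by
    rw [hη, hη', ← hkB]; push_cast; ring
  rw [Ideal.span_pair_mul_span_pair]
  apply le_antisymm
  · -- every generator is a multiple of `A`
    rw [Ideal.span_le]
    have hA : (A : 𝓞 K) ∈ span {(A : 𝓞 K)} := Ideal.subset_span rfl
    rintro y (rfl | rfl | rfl | rfl)
    · exact Ideal.mul_mem_left _ _ hA
    · exact Ideal.mul_mem_right _ _ hA
    · exact Ideal.mul_mem_left _ _ hA
    · rw [SetLike.mem_coe, hηη']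
      exact Submodule.neg_mem _ (Ideal.mul_mem_right _ _ hA)
  · rw [Ideal.span_le, Set.singleton_subset_iff, SetLike.mem_coe]
    set J : Ideal (𝓞 K) := span {(A : 𝓞 K) * A, (A : 𝓞 K) * η', η * A, η * η'} with hJ
    have h1 : (A : 𝓞 K) * A ∈ J := Ideal.subset_span (by simp)
    have h2 : (A : 𝓞 K) * η' ∈ J := Ideal.subset_span (by simp)
    have h3 : η * A ∈ J := Ideal.subset_span (by simp)
    have h4 : η * η' ∈ J := Ideal.subset_span (by simp)
    have hAB : (A : 𝓞 K) * B ∈ J := by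
      have : (A : 𝓞 K) * B = (A : 𝓞 K) * η' - η * A := by rw [← hηsub]; ring
      rw [this]
      exact Ideal.sub_mem _ h2 h3
    have hAC' : (A : 𝓞 K) * C ∈ J := by
      have : (A : 𝓞 K) * C = -(η * η') := by rw [hηη']; ring
      rw [this]
      exact Submodule.neg_mem _ h4
    obtain ⟨u, v, w, huvw⟩ := exists_bezout_three hprim
    have : (A : 𝓞 K) = (u : 𝓞 K) * ((A : 𝓞 K) * A) + (v : 𝓞 K) * ((A : 𝓞 K) * B) +
        (w : 𝓞 K) * ((A : 𝓞 K) * C) := by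
      have e : (u : 𝓞 K) * A + v * B + w * C = 1 := by exact_mod_cast congrArg (fun z : ℤ ↦ (z : 𝓞 K)) huvw
      linear_combination (-(A : 𝓞 K)) * e
    rw [this]
    exact Ideal.add_mem _ (Ideal.add_mem _ (Ideal.mul_mem_left _ _ h1) (Ideal.mul_mem_left _ _ hAB))
      (Ideal.mul_mem_left _ _ hAC')

/-- **The opposite form gives the inverse class**: `[𝔞_{(A,−B,C)}] = [𝔞_{(A,B,C)}]⁻¹` in `Cl(K)`
for a primitive form `(A, B, C)` of discriminant `d_K` with `A ≠ 0` (Mathlib's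
`ClassGroup.mk0_eq_mk0_inv_iff` and `span_formIdeal_mul_span_formIdeal_neg`).
[cite: Cox2013, §7.B Thm. 7.7] -/
theorem mk0_formIdeal_neg_eq_inv (b : Basis (Fin 2) ℤ (𝓞 K)) (hb : b 0 = 1)
    {t m : ℤ} (hω : b 1 * b 1 = (m : 𝓞 K) + (t : 𝓞 K) * b 1) {A B C : ℤ} (hA : A ≠ 0)
    (hdisc : B ^ 2 - 4 * A * C = t ^ 2 + 4 * m)
    (hprim : ∀ d : ℤ, d ∣ A → d ∣ B → d ∣ C → IsUnit d)
    (h𝔞 : span {(A : 𝓞 K), b 1 - (((B + t) / 2 : ℤ) : 𝓞 K)} ∈ (Ideal (𝓞 K))⁰)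
    (h𝔞' : span {(A : 𝓞 K), b 1 - (((-B + t) / 2 : ℤ) : 𝓞 K)} ∈ (Ideal (𝓞 K))⁰) :
    ClassGroup.mk0 ⟨_, h𝔞'⟩ = (ClassGroup.mk0 ⟨_, h𝔞⟩)⁻¹ := by
  rw [ClassGroup.mk0_eq_mk0_inv_iff]
  refine ⟨(A : 𝓞 K), fun h ↦ hA (intCast_eq_zero_of_basis b hb h), ?_⟩
  show span {(A : 𝓞 K), b 1 - (((-B + t) / 2 : ℤ) : 𝓞 K)} *
      span {(A : 𝓞 K), b 1 - (((B + t) / 2 : ℤ) : 𝓞 K)} = span {(A : 𝓞 K)}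
  rw [mul_comm]
  exact span_formIdeal_mul_span_formIdeal_neg b hb hω hdisc hprim

/-- **`ζ(𝔎⁻¹, s) = ζ(𝔎, s)` for the continued partial zeta functions of an imaginary quadratic
field** with `d_K = t² + 4m < −4`, for every class `𝔎` and every `s ≠ 1` (coordinates): `𝔎⁻¹ = [𝔞_Q]`
for a form `Q = (A, B, C)` of discriminant `d_K` (`exists_heegnerForm_mk0_formIdeal_eq`), so
`𝔎 = [𝔞_Q]⁻¹` and `𝔎⁻¹ = [𝔞_{(A,−B,C)}]⁻¹` (`mk0_formIdeal_neg_eq_inv`); both partial zeta functions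
are `½ Z_Q(s) = ½ Z_{(A,−B,C)}(s)` for `Re s > 1` (`classSumCont_eq_half_epsteinZeta`,
`epsteinZeta_neg_snd`) and holomorphic off `s = 1`, so they agree (identity theorem on `ℂ ∖ {1}`).
[cite: Cox2013, §7.B Thm. 7.7] -/
theorem classSumCont_inv_eq' (b : Basis (Fin 2) ℤ (𝓞 K)) (hb : b 0 = 1)
    {t m : ℤ} (hω : b 1 * b 1 = (m : 𝓞 K) + (t : 𝓞 K) * b 1) (hD : t ^ 2 + 4 * m < -4)
    (𝔎 : ClassGroup (𝓞 K)) {s : ℂ} (hs : s ≠ 1) :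
    classSumCont (thetaIdeal_inv_holds K) 𝔎⁻¹ s = classSumCont (thetaIdeal_inv_holds K) 𝔎 s := by
  classical
  have hneg : t ^ 2 + 4 * m < 0 := by linarith
  haveI : NeZero (1 : ℕ) := ⟨one_ne_zero⟩
  have hβ : (4 * (1 : ℕ) : ℤ) ∣ t ^ 2 - (t ^ 2 + 4 * m) := ⟨-m, by push_cast; ring⟩
  obtain ⟨Q, hQ, -, h0, hc⟩ := exists_heegnerForm_mk0_formIdeal_eq b hb hω hneg hβ 𝔎⁻¹
  obtain ⟨hdQ, hAQ, -, hprimQ⟩ := hQ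
  obtain ⟨A, B, C⟩ := Q
  dsimp only at hdQ hAQ hprimQ h0 hc
  -- `𝔎 = [𝔞_Q]⁻¹`, `𝔎⁻¹ = [𝔞_{Q'}]⁻¹`
  have h𝔎 : 𝔎 = (ClassGroup.mk0 ⟨_, h0⟩)⁻¹ := by rw [hc, inv_inv]
  have h0' := span_pair_intCast_mem_nonZeroDivisors b hb hAQ.ne' (b 1 - (((-B + t) / 2 : ℤ) : 𝓞 K))
  have h𝔎' : 𝔎⁻¹ = (ClassGroup.mk0 ⟨_, h0'⟩)⁻¹ := by
    rw [mk0_formIdeal_neg_eq_inv b hb hω hAQ.ne' hdQ hprimQ h0 h0', inv_inv, hc]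
  have hdQ' : (-B) ^ 2 - 4 * A * C = t ^ 2 + 4 * m := by rw [← hdQ]; ring
  -- both sides are holomorphic off `1` and agree on `Re s > 1`
  set F : ℂ → ℂ := fun z ↦ classSumCont (thetaIdeal_inv_holds K) 𝔎⁻¹ z with hF
  set G : ℂ → ℂ := fun z ↦ classSumCont (thetaIdeal_inv_holds K) 𝔎 z with hG
  have hopen : IsOpen ({1}ᶜ : Set ℂ) := isOpen_compl_singleton
  have hFa := (differentiableOn_classSumCont (thetaIdeal_inv_holds K) 𝔎⁻¹).analyticOnNhd hopen
  have hGa := (differentiableOn_classSumCont (thetaIdeal_inv_holds K) 𝔎).analyticOnNhd hopen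
  have h2 : (2 : ℂ) ∈ ({1}ᶜ : Set ℂ) := by norm_num
  have hpre : IsPreconnected ({1}ᶜ : Set ℂ) := by
    have e : ({1}ᶜ : Set ℂ) = {s : ℂ | s ≠ 1} := by ext z; simp
    rw [e]
    exact isPreconnected_compl_one
  refine hFa.eqOn_of_preconnected_of_eventuallyEq hGa hpre h2 ?_ (Set.mem_compl_singleton_iff.mpr hs)
  have hnhds : {z : ℂ | 1 < z.re} ∈ nhds (2 : ℂ) :=
    (isOpen_lt continuous_const Complex.continuous_re).mem_nhds (by norm_num)
  filter_upwards [hnhds] with z hz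
  show classSumCont (thetaIdeal_inv_holds K) 𝔎⁻¹ z = classSumCont (thetaIdeal_inv_holds K) 𝔎 z
  rw [h𝔎', classSumCont_eq_half_epsteinZeta b hb hω hD hAQ hdQ' h0' hz]
  conv_rhs => rw [h𝔎, classSumCont_eq_half_epsteinZeta b hb hω hD hAQ hdQ h0 hz]
  rw [Int.cast_neg, epsteinZeta_neg_snd]

end Basis

section Field

variable {K : Type*} [Field K] [NumberField K]

/-- **`ζ(𝔎⁻¹, s) = ζ(𝔎, s)`** (`s ≠ 1`) for every ideal class `𝔎` of an imaginary quadratic field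
`K` with `d_K < −4` (the cases `d_K = −3, −4` have `h_K = 1` and are not needed here).
[cite: Cox2013, §7.B Thm. 7.7] -/
theorem classSumCont_inv_eq (h2 : finrank ℚ K = 2) (hd : NumberField.discr K < -4)
    (𝔎 : ClassGroup (𝓞 K)) {s : ℂ} (hs : s ≠ 1) :
    classSumCont (thetaIdeal_inv_holds K) 𝔎⁻¹ s = classSumCont (thetaIdeal_inv_holds K) 𝔎 s := by
  obtain ⟨b, hb⟩ := exists_basis_zero_eq_one (K := K) h2
  have hω := basis_one_mul_self_eq b hb
  have hD := discr_eq_sq_add_four_mul b hb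
  exact classSumCont_inv_eq' b hb hω (by rw [← hD]; exact hd) 𝔎 hs

/-! ### `h(d_K) > 1 ⇒ h_K ≥ 2`, and `d < −4` -/

/-- The barrier's proper equivalence of coefficient triples is the tree's `BinQF.ProperEquiv`.
[folklore] -/
theorem properlyEquivalent_iff_properEquiv (Q₁ Q₂ : ℤ × ℤ × ℤ) :
    ProperlyEquivalent Q₁ Q₂ ↔
      (BinQF.mk Q₁.1 Q₁.2.1 Q₁.2.2).ProperEquiv (BinQF.mk Q₂.1 Q₂.2.1 Q₂.2.2) := by
  obtain ⟨A, B, C⟩ := Q₁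
  obtain ⟨A', B', C'⟩ := Q₂
  simp only [ProperlyEquivalent, BinQF.ProperEquiv, BinQF.act, BinQF.mk.injEq]

/-- **`h(d_K) > 1 ⇒ h_K ≥ 2`** (coordinates `d_K = t² + 4m < 0`): two positive definite integral
forms of discriminant `d_K` that are not properly equivalent are primitive
(`isUnit_of_dvd_of_disc_eq`), properly equivalent to two reduced forms (Cox, Thm. 2.8), which are
then distinct; and the reduced forms of discriminant `d_K` are in bijection with `Cl(K)`
(`card_reducedForms_eq_classNumber'`). [cite: Cox2013, Thm. 2.8 and §7.B Thm. 7.7(ii)] -/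
theorem two_le_classNumber_of_twoFormClasses' (b : Basis (Fin 2) ℤ (𝓞 K)) (hb : b 0 = 1)
    {t m : ℤ} (hω : b 1 * b 1 = (m : 𝓞 K) + (t : 𝓞 K) * b 1) (hneg : t ^ 2 + 4 * m < 0)
    (hT : TwoFormClasses (t ^ 2 + 4 * m)) : 2 ≤ classNumber K := by
  classical
  set D : ℤ := t ^ 2 + 4 * m with hDdef
  obtain ⟨Q₁, Q₂, hA₁, hA₂, hd₁, hd₂, hne⟩ := hT
  set f₁ : BinQF := ⟨Q₁.1, Q₁.2.1, Q₁.2.2⟩ with hf₁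
  set f₂ : BinQF := ⟨Q₂.1, Q₂.2.1, Q₂.2.2⟩ with hf₂
  have hpp : ∀ {Q : ℤ × ℤ × ℤ}, 0 < Q.1 → formDisc Q = D →
      (BinQF.mk Q.1 Q.2.1 Q.2.2).IsPosPrim D := fun {Q} hA hd ↦
    { disc_eq := hd
      a_pos := hA
      primitive := (BinQF.isPrimitive_iff _).2 fun d hdA hdB hdC ↦
        isUnit_of_dvd_of_disc_eq b hb hω (A := Q.1) (B := Q.2.1) (C := Q.2.2) hd hdA hdB hdC }
  have hpp₁ : f₁.IsPosPrim D := hpp hA₁ hd₁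
  have hpp₂ : f₂.IsPosPrim D := hpp hA₂ hd₂
  obtain ⟨g₁, hfg₁, hred₁⟩ := BinQF.exists_properEquiv_isReduced hneg hpp₁
  obtain ⟨g₂, hfg₂, hred₂⟩ := BinQF.exists_properEquiv_isReduced hneg hpp₂
  have hg₁ : g₁.IsPosPrim D := hfg₁.isPosPrim hneg hpp₁
  have hg₂ : g₂.IsPosPrim D := hfg₂.isPosPrim hneg hpp₂
  have hmem : ∀ {g : BinQF}, g.IsPosPrim D → g.IsReduced → (g.a, g.b, g.c) ∈ reducedForms D :=
    fun {g} hg hred ↦ by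
      rw [mem_reducedForms_iff hneg]
      exact ⟨hg.disc_eq, hg.a_pos, hg.primitive, (isReduced_iff g.a g.b g.c).2 hred⟩
  have hne' : (g₁.a, g₁.b, g₁.c) ≠ (g₂.a, g₂.b, g₂.c) := by
    intro heq
    have hg : g₁ = g₂ := by
      simp only [Prod.mk.injEq] at heq
      exact BinQF.ext heq.1 heq.2.1 heq.2.2
    apply hne
    rw [properlyEquivalent_iff_properEquiv]
    exact hfg₁.trans (hg ▸ hfg₂.symm)
  have hcard : 2 ≤ (reducedForms D).card := by
    have hsub : ({(g₁.a, g₁.b, g₁.c), (g₂.a, g₂.b, g₂.c)} : Finset (ℤ × ℤ × ℤ)) ⊆ reducedForms D := by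
      intro x hx
      rcases Finset.mem_insert.1 hx with rfl | hx
      · exact hmem hg₁ hred₁
      · rw [Finset.mem_singleton.1 hx]
        exact hmem hg₂ hred₂
    have := Finset.card_le_card hsub
    rwa [Finset.card_pair hne'] at this
  rwa [hDdef, card_reducedForms_eq_classNumber' b hb hω hneg] at hcard

/-- **`h(d_K) > 1 ⇒ h_K ≥ 2`**: if two positive definite integral forms of discriminant `d_K < 0`
are not properly equivalent (`TwoFormClasses d_K`), the class number of `K` is at least `2`.
[cite: Cox2013, Thm. 2.8 and §7.B Thm. 7.7(ii)] -/
theorem two_le_classNumber_of_twoFormClasses (h2 : finrank ℚ K = 2) (hd : NumberField.discr K < 0)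
    (hT : TwoFormClasses (NumberField.discr K)) : 2 ≤ classNumber K := by
  obtain ⟨b, hb⟩ := exists_basis_zero_eq_one (K := K) h2
  have hω := basis_one_mul_self_eq b hb
  have hD := discr_eq_sq_add_four_mul b hb
  rw [hD] at hd hT
  exact two_le_classNumber_of_twoFormClasses' b hb hω hd hT

end Field

/-- `h(−3) = 1`: the only reduced form of discriminant `−3` is `x² + xy + y²`. [folklore] -/
theorem classNumber_neg_three : BinaryQuadraticForm.classNumber (-3) = 1 := by
  decide

/-- `h(−4) = 1`: the only reduced form of discriminant `−4` is `x² + y²`. [folklore] -/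
theorem classNumber_neg_four : BinaryQuadraticForm.classNumber (-4) = 1 := by
  decide

/-- A negative fundamental discriminant `d ≥ −4` is `−3` or `−4`. [folklore] -/
theorem eq_neg_three_or_neg_four_of_isFundamental {d : ℤ} (hd : IsFundamentalDiscriminant d)
    (hd0 : d < 0) (h4 : -4 ≤ d) : d = -3 ∨ d = -4 := by
  rcases hd with ⟨h1, -, -⟩ | ⟨h4d, -, -⟩ <;> omega

/-- **`h(d) > 1` forces `d < −4`**: a negative fundamental discriminant `d` admitting two
positive definite integral forms of discriminant `d` that are not properly equivalent satisfies
`d < −4`, since `h(−3) = h(−4) = 1` (through the quadratic field `K = ℚ(√d)`: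
`2 ≤ h_K = h(d_K)`, `exists_numberField_discr_eq`, `card_reducedForms_eq_classNumber`). [folklore] -/
theorem lt_neg_four_of_twoFormClasses {d : ℤ} (hd : IsFundamentalDiscriminant d) (hd0 : d < 0)
    (hT : TwoFormClasses d) : d < -4 := by
  by_contra h4
  push Not at h4
  obtain ⟨K, _, _, h2, hdK⟩ := exists_numberField_discr_eq hd
  have hT' : TwoFormClasses (NumberField.discr K) := by rwa [hdK]
  have h2le := two_le_classNumber_of_twoFormClasses h2 (by rw [hdK]; exact hd0) hT'
  rw [← card_reducedForms_eq_classNumber h2 (by rw [hdK]; exact hd0), hdK] at h2le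
  rcases eq_neg_three_or_neg_four_of_isFundamental hd hd0 h4 with rfl | rfl
  · rw [classNumber_neg_three] at h2le; omega
  · rw [classNumber_neg_four] at h2le; omega

end Literature.NumberTheory.QuadraticFields.Quadratic
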